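import Mathlib.Analysis.Complex.AbsMax
import Mathlib.Analysis.SpecialFunctions.Complex.Log
import Mathlib.Analysis.SpecialFunctions.ExpDeriv
import HarnessLib

/-!
# The maximum principle for the real part of a holomorphic function (several variables),
# and its cocompact-quotient form

Topic `Analysis/Complex`; namespace `Literature.Analysis.Complex`. Theorems only (no definition,
no named fact, no `sorry`).

Let `E` be a complex normed space (any number of variables) and `f : E → ℂ`.

* `eventually_eq_of_isLocalMax_re` — if `f` is complex differentiable near `c` and `z ↦ Re f z`
  has a local maximum at `c`, then `f` is constant near `c`. Proof: `‖exp ∘ f‖ = exp ∘ Re f` has a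
  local maximum, so Mathlib's maximum modulus principle `Complex.eventually_eq_of_isLocalMax_norm`
  makes `exp ∘ f` locally constant, and `exp (f z) = exp (f c)` with `f z` close to `f c` forces
  `f z = f c`. Minimum and imaginary-part variants.
* `eqOn_of_isPreconnected_of_isMaxOn_re` — on an open preconnected `U`, a holomorphic `f` whose
  real part attains its maximum over `U` at a point of `U` is constant on `U` (clopen argument).
* COCOMPACT-QUOTIENT FORM. `exists_isCompact_subset_image_eq_univ`: an open map from an open
  subset `U` of a locally compact space ONTO a compact space `β` maps some compact `K ⊆ U` onto
  `β` (a compact "fundamental set"); `exists_isMaxOn_of_fibre_constant`: hence a function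
  continuous on `U` and constant on the fibres of such a map attains its maximum on `U`;
  `exists_eqOn_const_of_re_fibre_constant`: so a holomorphic function on an open preconnected
  `U` whose REAL PART is constant on the fibres of an open surjection `ψ|U` onto a compact space is
  constant (and `fderiv ℂ f = 0` on `U`). Typical use: `U = 𝔹ⁿ` a bounded symmetric domain,
  `ψ : 𝔹ⁿ → Γ\𝔹ⁿ = X(ℂ)` the uniformisation of a compact quotient, `f` a holomorphic primitive
  whose periods `f(γz) - f(z)` are purely imaginary — then `f` is constant; this is the step
  "the period lattice spans the dual of the space of holomorphic one-forms over `ℝ`" in the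
  construction of the Albanese torus of a compact ball quotient.

Mathlib (pinned) has the maximum MODULUS principle in this generality
(`Mathlib/Analysis/Complex/AbsMax.lean`) but no real-part form; the tree's
`Analysis/Complex/HarmonicMaxPrinciple.lean` treats harmonic `f : ℂ → ℝ` in ONE variable.

Sources: L. Hörmander, *An Introduction to Complex Analysis in Several Variables* (3rd ed. 1990),
Thm. 1.2.11 and Cor. 1.2.12 (one variable) with §2.2, remark after Thm. 2.2.7 ("the maximum
principle also extends immediately from one to several variables"); J. B. Conway, *Functions of One
Complex Variable I* (1978), Ch. X §1 (maximum principle for harmonic functions = real parts);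
K. Kodaira, *Complex Manifolds and Deformation of Complex Structures* (2005), §2.2, Thm. 2.1
(holomorphic functions on a compact complex manifold are constant) — the cocompact form below is
the same argument run upstairs on the uniformising domain; N. Bourbaki, *General Topology*, Ch. I
§10 no. 4 Prop. 10 (compact subsets of an open quotient of a locally compact space lift to compact
subsets) and §5 no. 1 (open mappings).
-/

noncomputable section

open Set Filter Topology Complex

namespace Literature.Analysis.Complex

/-! ### Local form -/

section Local

variable {E : Type*} [NormedAddCommGroup E] [NormedSpace ℂ E]

/-- Two complex numbers with the same exponential and at distance `< π` are equal (the non-zero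
periods of `exp` have modulus `≥ 2π`). [folklore] -/
private theorem eq_of_exp_eq_of_norm_sub_lt {a b : ℂ} (h : exp a = exp b) (hab : ‖a - b‖ < Real.pi) :
    a = b := by
  obtain ⟨n, hn⟩ := Complex.exp_eq_exp_iff_exists_int.mp h
  have hsub : a - b = n * (2 * Real.pi * I) := by rw [hn]; ring
  rw [hsub] at hab
  by_contra hne
  have hn0 : n ≠ 0 := by
    rintro rfl
    apply hne
    simpa using hn
  have h1 : (1 : ℝ) ≤ |(n : ℝ)| := by
    rw [← Int.cast_abs]; exact_mod_cast Int.one_le_abs hn0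
  have hnorm : ‖(n : ℂ) * (2 * Real.pi * I)‖ = |(n : ℝ)| * (2 * Real.pi) := by
    rw [norm_mul, Complex.norm_intCast, norm_mul, Complex.norm_I, mul_one, norm_mul,
      Complex.norm_real, Real.norm_of_nonneg Real.pi_pos.le, Complex.norm_two]
  rw [hnorm] at hab
  nlinarith [Real.pi_pos]

/-- **Maximum principle for the real part, local form (several variables).** If `f : E → ℂ` is
complex differentiable in a neighbourhood of `c` and `z ↦ Re f z` has a local maximum at `c`,
then `f` is constant in a neighbourhood of `c`. (Apply the maximum modulus principle to
`exp ∘ f`, `‖exp (f z)‖ = exp (Re f z)`.) [cite: HormanderSCV1990, Thm. 1.2.11 and §2.2 (remark after Thm. 2.2.7)] -/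
theorem eventually_eq_of_isLocalMax_re {f : E → ℂ} {c : E}
    (hd : ∀ᶠ z in 𝓝 c, DifferentiableAt ℂ f z) (hc : IsLocalMax (fun z ↦ (f z).re) c) :
    ∀ᶠ z in 𝓝 c, f z = f c := by
  have hd' : ∀ᶠ z in 𝓝 c, DifferentiableAt ℂ (fun z ↦ exp (f z)) z :=
    hd.mono fun z hz ↦ hz.cexp
  have hc' : IsLocalMax (norm ∘ fun z ↦ exp (f z)) c :=
    hc.mono fun z hz ↦ by simpa only [Function.comp_apply, Complex.norm_exp, Real.exp_le_exp]
  have h1 : ∀ᶠ z in 𝓝 c, exp (f z) = exp (f c) := Complex.eventually_eq_of_isLocalMax_norm hd' hc'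
  have hcont : ContinuousAt f c := hd.self_of_nhds.continuousAt
  have h2 : ∀ᶠ z in 𝓝 c, ‖f z - f c‖ < Real.pi := by
    have := (Metric.tendsto_nhds.mp hcont) Real.pi Real.pi_pos
    exact this.mono fun z hz ↦ by rwa [dist_eq_norm] at hz
  filter_upwards [h1, h2] with z hz1 hz2
  exact eq_of_exp_eq_of_norm_sub_lt hz1 hz2

/-- Minimum form: a local MINIMUM of `Re f` at a point near which `f` is complex differentiable
forces `f` to be locally constant. [cite: HormanderSCV1990, Thm. 1.2.11 and §2.2 (remark after Thm. 2.2.7)] -/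
theorem eventually_eq_of_isLocalMin_re {f : E → ℂ} {c : E}
    (hd : ∀ᶠ z in 𝓝 c, DifferentiableAt ℂ f z) (hc : IsLocalMin (fun z ↦ (f z).re) c) :
    ∀ᶠ z in 𝓝 c, f z = f c := by
  have hd' : ∀ᶠ z in 𝓝 c, DifferentiableAt ℂ (fun z ↦ -f z) z := hd.mono fun z hz ↦ hz.neg
  have hc' : IsLocalMax (fun z ↦ (-f z).re) c :=
    hc.mono fun z hz ↦ by simpa only [Complex.neg_re, neg_le_neg_iff]
  exact (eventually_eq_of_isLocalMax_re hd' hc').mono fun z hz ↦ neg_injective hz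

/-- Imaginary-part form: a local maximum of `Im f` forces `f` to be locally constant
(`Im f = Re (-I • f)`). [cite: HormanderSCV1990, Thm. 1.2.11 and §2.2 (remark after Thm. 2.2.7)] -/
theorem eventually_eq_of_isLocalMax_im {f : E → ℂ} {c : E}
    (hd : ∀ᶠ z in 𝓝 c, DifferentiableAt ℂ f z) (hc : IsLocalMax (fun z ↦ (f z).im) c) :
    ∀ᶠ z in 𝓝 c, f z = f c := by
  have hd' : ∀ᶠ z in 𝓝 c, DifferentiableAt ℂ (fun z ↦ -I * f z) z :=
    hd.mono fun z hz ↦ hz.const_mul _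
  have hc' : IsLocalMax (fun z ↦ (-I * f z).re) c :=
    hc.mono fun z hz ↦ by simpa using hz
  refine (eventually_eq_of_isLocalMax_re hd' hc').mono fun z hz ↦ ?_
  have hI : (-I : ℂ) ≠ 0 := by simp
  exact mul_left_cancel₀ hI hz

end Local

/-! ### Global form on a preconnected open set -/

section Global

variable {E : Type*} [NormedAddCommGroup E] [NormedSpace ℂ E]

/-- **Maximum principle for the real part (several variables).** Let `U` be an open preconnected
subset of a complex normed space and `f : E → ℂ` complex differentiable on `U`. If `Re f`
attains its maximum over `U` at some `c ∈ U`, then `f` is constant on `U`. [cite: HormanderSCV1990, Thm. 1.2.11, Cor. 1.2.12 and §2.2 (remark after Thm. 2.2.7)] -/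
theorem eqOn_of_isPreconnected_of_isMaxOn_re {f : E → ℂ} {U : Set E} {c : E}
    (hc : IsPreconnected U) (ho : IsOpen U) (hd : DifferentiableOn ℂ f U) (hcU : c ∈ U)
    (hm : IsMaxOn (fun z ↦ (f z).re) U c) : EqOn f (Function.const E (f c)) U := by
  have hcont : ContinuousOn f U := hd.continuousOn
  -- the set where `f = f c` is open (local form at each of its points) …
  set S : Set E := {z | z ∈ U ∧ f z = f c} with hS
  have hSo : IsOpen S := by
    rw [isOpen_iff_mem_nhds]
    rintro z ⟨hzU, hzc⟩
    have hUz : U ∈ 𝓝 z := ho.mem_nhds hzU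
    have hdz : ∀ᶠ w in 𝓝 z, DifferentiableAt ℂ f w :=
      Filter.eventually_of_mem hUz fun w hw ↦ hd.differentiableAt (ho.mem_nhds hw)
    have hmax : IsLocalMax (fun w ↦ (f w).re) z :=
      Filter.eventually_of_mem hUz fun w hw ↦ by
        show (f w).re ≤ (f z).re
        rw [hzc]; exact hm hw
    have hev := eventually_eq_of_isLocalMax_re hdz hmax
    filter_upwards [hev, hUz] with w hw hwU
    exact ⟨hwU, by rw [hw, hzc]⟩
  -- … and so is its complement in `U`
  set V : Set E := {z | z ∈ U ∧ f z ≠ f c} with hV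
  have hVo : IsOpen V := hcont.isOpen_inter_preimage ho isOpen_ne
  have hcover : U ⊆ S ∪ V := fun z hz ↦ by
    by_cases h : f z = f c
    · exact Or.inl ⟨hz, h⟩
    · exact Or.inr ⟨hz, h⟩
  have hdisj : Disjoint S V := Set.disjoint_left.2 fun z hzS hzV ↦ hzV.2 hzS.2
  rcases hc.subset_or_subset hSo hVo hdisj hcover with h | h
  · exact fun z hz ↦ (h hz).2
  · exact absurd rfl (h hcU).2

/-- Minimum form of `eqOn_of_isPreconnected_of_isMaxOn_re`. [cite: HormanderSCV1990, Thm. 1.2.11, Cor. 1.2.12 and §2.2 (remark after Thm. 2.2.7)] -/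
theorem eqOn_of_isPreconnected_of_isMinOn_re {f : E → ℂ} {U : Set E} {c : E}
    (hc : IsPreconnected U) (ho : IsOpen U) (hd : DifferentiableOn ℂ f U) (hcU : c ∈ U)
    (hm : IsMinOn (fun z ↦ (f z).re) U c) : EqOn f (Function.const E (f c)) U := by
  have hm' : IsMaxOn (fun z ↦ (-f z).re) U c := fun z hz ↦ by
    simpa only [Complex.neg_re, mem_setOf_eq, neg_le_neg_iff] using hm hz
  have h := eqOn_of_isPreconnected_of_isMaxOn_re hc ho hd.neg hcU hm'
  exact fun z hz ↦ neg_injective (h hz)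

/-- A function complex differentiable on an open preconnected set whose real part attains a
maximum there has derivative zero on the set. [cite: HormanderSCV1990, Thm. 1.2.11, Cor. 1.2.12 and §2.2 (remark after Thm. 2.2.7)] -/
theorem fderiv_eq_zero_of_isMaxOn_re {f : E → ℂ} {U : Set E} {c : E}
    (hc : IsPreconnected U) (ho : IsOpen U) (hd : DifferentiableOn ℂ f U) (hcU : c ∈ U)
    (hm : IsMaxOn (fun z ↦ (f z).re) U c) {z : E} (hz : z ∈ U) : fderiv ℂ f z = 0 := by
  have h := eqOn_of_isPreconnected_of_isMaxOn_re hc ho hd hcU hm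
  have hev : f =ᶠ[𝓝 z] Function.const E (f c) :=
    Filter.eventually_of_mem (ho.mem_nhds hz) fun w hw ↦ h hw
  rw [hev.fderiv_eq]; exact fderiv_const_apply _

end Global

/-! ### Cocompact quotients: invariant functions attain their extrema -/

section Cocompact

variable {α β : Type*} [TopologicalSpace α] [TopologicalSpace β]

/-- Openness of a restriction `ψ|U` to an OPEN set `U`, from openness of the images of the open
subsets of `U` (the form in which uniformisation data usually record it). [cite: BourbakiGT1, Ch. I §5 no. 1] -/
theorem isOpenMap_restrict_of_forall_isOpen_image {U : Set α} (hU : IsOpen U) {ψ : α → β}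
    (h : ∀ s : Set α, IsOpen s → s ⊆ U → IsOpen (ψ '' s)) : IsOpenMap (U.restrict ψ) := by
  intro s hs
  rw [Set.restrict_eq, Set.image_comp]
  exact h _ (hU.isOpenMap_subtype_val s hs) (Subtype.coe_image_subset U s)

/-- Conversely, if `ψ|U` is open then `ψ` maps open subsets of `U` to open sets. [cite: BourbakiGT1, Ch. I §5 no. 1] -/
theorem isOpen_image_of_isOpenMap_restrict {U : Set α} {ψ : α → β} (h : IsOpenMap (U.restrict ψ))
    {s : Set α} (hs : IsOpen s) (hsU : s ⊆ U) : IsOpen (ψ '' s) := by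
  have : ψ '' s = (U.restrict ψ) '' (Subtype.val ⁻¹' s) := by
    rw [Set.restrict_eq, Set.image_comp, Subtype.image_preimage_coe, Set.inter_eq_right.2 hsU]
  rw [this]
  exact h _ (hs.preimage continuous_subtype_val)

/-- **A compact fundamental set.** An open map from an open subset `U` of a locally compact space
onto a compact space `β` maps some compact `K ⊆ U` onto `β`. (For the uniformisation
`ψ : 𝔹 → Γ\𝔹` of a compact quotient: a compact subset of the domain meeting every orbit.) [folklore] -/
private theorem exists_isCompact_subset_image_eq_univ_aux [LocallyCompactSpace α] [CompactSpace β]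
    {U : Set α} (hU : IsOpen U) {ψ : α → β} (hopen : IsOpenMap (U.restrict ψ))
    (hsurj : SurjOn ψ U univ) : ∃ K : Set α, IsCompact K ∧ K ⊆ U ∧ ψ '' K = univ := by
  classical
  have hK : ∀ z : U, ∃ K : Set α, K ∈ 𝓝 (z : α) ∧ K ⊆ U ∧ IsCompact K := fun z ↦
    LocallyCompactSpace.local_compact_nhds _ _ (hU.mem_nhds z.2)
  choose K hKn hKU hKc using hK
  let O : U → Set β := fun z ↦ (U.restrict ψ) '' (Subtype.val ⁻¹' interior (K z))
  have hOo : ∀ z, IsOpen (O z) := fun z ↦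
    hopen _ (isOpen_interior.preimage continuous_subtype_val)
  have hcov : (univ : Set β) ⊆ ⋃ z, O z := fun y _ ↦ by
    obtain ⟨x, hxU, rfl⟩ := hsurj (mem_univ y)
    exact mem_iUnion.2 ⟨⟨x, hxU⟩, ⟨⟨x, hxU⟩, mem_interior_iff_mem_nhds.2 (hKn ⟨x, hxU⟩), rfl⟩⟩
  obtain ⟨t, ht⟩ := isCompact_univ.elim_finite_subcover O hOo hcov
  refine ⟨⋃ z ∈ t, K z, t.isCompact_biUnion fun z _ ↦ hKc z, iUnion₂_subset fun z _ ↦ hKU z, ?_⟩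
  refine eq_univ_of_univ_subset fun y hy ↦ ?_
  obtain ⟨z, hzt, hy⟩ := mem_iUnion₂.1 (ht hy)
  obtain ⟨x, hxK, rfl⟩ := hy
  exact ⟨x, mem_iUnion₂.2 ⟨z, hzt, interior_subset hxK⟩, rfl⟩

/-- **A compact fundamental set** for an open surjection `ψ|U : U → β` from an open subset of a
locally compact space onto a compact space: some compact `K ⊆ U` satisfies `ψ '' K = β`. For
`ψ` the uniformisation of a compact quotient `Γ\D` of a domain `D`, `K` is a compact subset of `D`
meeting every `Γ`-orbit. Bourbaki, *General Topology* I §10 no. 4 Prop. 10 (with `K' = β`).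
[cite: BourbakiGT1, Ch. I §10 no. 4 Prop. 10] -/
theorem exists_isCompact_subset_image_eq_univ [LocallyCompactSpace α] [CompactSpace β]
    {U : Set α} (hU : IsOpen U) {ψ : α → β} (hopen : IsOpenMap (U.restrict ψ))
    (hsurj : SurjOn ψ U univ) : ∃ K : Set α, IsCompact K ∧ K ⊆ U ∧ ψ '' K = univ :=
  exists_isCompact_subset_image_eq_univ_aux hU hopen hsurj

/-- **Invariant functions attain their maximum.** Let `ψ|U : U → β` be an open surjection from an
open subset of a locally compact space onto a compact space, and `u : α → γ` (values in a linear
order) continuous on `U` and constant on the fibres of `ψ` (e.g. a `Γ`-invariant function on the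
domain uniformising a compact quotient `Γ\D`). If `U` is non-empty, `u` attains its maximum over
`U`. [cite: BourbakiGT1, Ch. I §10 no. 4 Prop. 10] [cite: Kodaira2005, §2.2 Thm. 2.1 (proof)] -/
theorem exists_isMaxOn_of_fibre_constant [LocallyCompactSpace α] [CompactSpace β]
    {γ : Type*} [LinearOrder γ] [TopologicalSpace γ] [ClosedIciTopology γ]
    {U : Set α} (hU : IsOpen U) {ψ : α → β} (hopen : IsOpenMap (U.restrict ψ))
    (hsurj : SurjOn ψ U univ) {u : α → γ} (hu : ContinuousOn u U)
    (hfib : ∀ z ∈ U, ∀ w ∈ U, ψ z = ψ w → u z = u w) (hne : U.Nonempty) :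
    ∃ c ∈ U, IsMaxOn u U c := by
  obtain ⟨K, hKc, hKU, hKψ⟩ := exists_isCompact_subset_image_eq_univ hU hopen hsurj
  obtain ⟨z₀, hz₀⟩ := hne
  have hKne : K.Nonempty := by
    have : ψ z₀ ∈ ψ '' K := by rw [hKψ]; exact mem_univ _
    obtain ⟨k, hk, -⟩ := this
    exact ⟨k, hk⟩
  obtain ⟨c, hcK, hcmax⟩ := hKc.exists_isMaxOn hKne (hu.mono hKU)
  refine ⟨c, hKU hcK, fun z hz ↦ ?_⟩
  have : ψ z ∈ ψ '' K := by rw [hKψ]; exact mem_univ _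
  obtain ⟨k, hk, hkz⟩ := this
  rw [mem_setOf_eq, ← hfib k (hKU hk) z hz hkz]
  exact hcmax hk

/-- Minimum form of `exists_isMaxOn_of_fibre_constant`. [cite: BourbakiGT1, Ch. I §10 no. 4 Prop. 10] -/
theorem exists_isMinOn_of_fibre_constant [LocallyCompactSpace α] [CompactSpace β]
    {γ : Type*} [LinearOrder γ] [TopologicalSpace γ] [ClosedIicTopology γ]
    {U : Set α} (hU : IsOpen U) {ψ : α → β} (hopen : IsOpenMap (U.restrict ψ))
    (hsurj : SurjOn ψ U univ) {u : α → γ} (hu : ContinuousOn u U)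
    (hfib : ∀ z ∈ U, ∀ w ∈ U, ψ z = ψ w → u z = u w) (hne : U.Nonempty) :
    ∃ c ∈ U, IsMinOn u U c :=
  exists_isMaxOn_of_fibre_constant (γ := γᵒᵈ) hU hopen hsurj hu hfib hne

end Cocompact

/-! ### Holomorphic functions with invariant real part on a cocompact domain are constant -/

section Holomorphic

variable {E : Type*} [NormedAddCommGroup E] [NormedSpace ℂ E] [LocallyCompactSpace E]
  {β : Type*} [TopologicalSpace β] [CompactSpace β]

/-- **Cocompact-quotient form of the maximum principle.** Let `U` be an open preconnected subset
of a finite-dimensional (locally compact) complex normed space, `ψ|U : U → β` an open surjection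
onto a compact space (a uniformisation `D → Γ\D` of a compact quotient), and `f : E → ℂ` complex
differentiable on `U` whose REAL PART is constant on the fibres of `ψ` (e.g. `f` a holomorphic
primitive with purely imaginary periods `f(γz) - f(z)`). Then `f` is constant on `U`: `Re f`
attains its maximum on `U` (`exists_isMaxOn_of_fibre_constant`) and the maximum principle for the
real part applies. [cite: Kodaira2005, §2.2 Thm. 2.1] [cite: HormanderSCV1990, §2.2 (remark after Thm. 2.2.7)] -/
theorem exists_eqOn_const_of_re_fibre_constant {U : Set E} (hU : IsOpen U) (hUc : IsPreconnected U)
    {ψ : E → β} (hopen : IsOpenMap (U.restrict ψ)) (hsurj : SurjOn ψ U univ) {f : E → ℂ}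
    (hd : DifferentiableOn ℂ f U)
    (hfib : ∀ z ∈ U, ∀ w ∈ U, ψ z = ψ w → (f z).re = (f w).re) :
    ∃ a : ℂ, EqOn f (Function.const E a) U := by
  rcases U.eq_empty_or_nonempty with hUe | hne
  · exact ⟨0, by rw [hUe]; exact eqOn_empty _ _⟩
  obtain ⟨c, hcU, hmax⟩ := exists_isMaxOn_of_fibre_constant hU hopen hsurj
    (Complex.continuous_re.comp_continuousOn hd.continuousOn) hfib hne
  exact ⟨f c, eqOn_of_isPreconnected_of_isMaxOn_re hUc hU hd hcU hmax⟩

/-- Base-point spelling of `exists_eqOn_const_of_re_fibre_constant`: `f = f z₀` on `U` for any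
`z₀ ∈ U`. [cite: Kodaira2005, §2.2 Thm. 2.1] -/
theorem eqOn_const_of_re_fibre_constant {U : Set E} (hU : IsOpen U) (hUc : IsPreconnected U)
    {ψ : E → β} (hopen : IsOpenMap (U.restrict ψ)) (hsurj : SurjOn ψ U univ) {f : E → ℂ}
    (hd : DifferentiableOn ℂ f U)
    (hfib : ∀ z ∈ U, ∀ w ∈ U, ψ z = ψ w → (f z).re = (f w).re)
    {z₀ : E} (hz₀ : z₀ ∈ U) : EqOn f (Function.const E (f z₀)) U := by
  obtain ⟨a, ha⟩ := exists_eqOn_const_of_re_fibre_constant hU hUc hopen hsurj hd hfib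
  intro z hz
  have h1 := ha hz
  have h2 := ha hz₀
  simp only [Function.const_apply] at h1 h2 ⊢
  rw [h1, h2]

/-- Pointwise spelling of `exists_eqOn_const_of_re_fibre_constant`: `f z = f w` for all
`z, w ∈ U`. [cite: Kodaira2005, §2.2 Thm. 2.1] -/
theorem eq_of_re_fibre_constant {U : Set E} (hU : IsOpen U) (hUc : IsPreconnected U)
    {ψ : E → β} (hopen : IsOpenMap (U.restrict ψ)) (hsurj : SurjOn ψ U univ) {f : E → ℂ}
    (hd : DifferentiableOn ℂ f U)
    (hfib : ∀ z ∈ U, ∀ w ∈ U, ψ z = ψ w → (f z).re = (f w).re)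
    {z w : E} (hz : z ∈ U) (hw : w ∈ U) : f z = f w := by
  obtain ⟨a, ha⟩ := exists_eqOn_const_of_re_fibre_constant hU hUc hopen hsurj hd hfib
  rw [ha hz, ha hw]
  rfl

/-- Derivative spelling of `exists_eqOn_const_of_re_fibre_constant`: `fderiv ℂ f = 0` on `U`
(so a holomorphic one-form `df` on the domain with purely imaginary periods vanishes).
[cite: Kodaira2005, §2.2 Thm. 2.1] -/
theorem fderiv_eq_zero_of_re_fibre_constant {U : Set E} (hU : IsOpen U) (hUc : IsPreconnected U)
    {ψ : E → β} (hopen : IsOpenMap (U.restrict ψ)) (hsurj : SurjOn ψ U univ) {f : E → ℂ}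
    (hd : DifferentiableOn ℂ f U)
    (hfib : ∀ z ∈ U, ∀ w ∈ U, ψ z = ψ w → (f z).re = (f w).re)
    {z : E} (hz : z ∈ U) : fderiv ℂ f z = 0 := by
  obtain ⟨a, ha⟩ := exists_eqOn_const_of_re_fibre_constant hU hUc hopen hsurj hd hfib
  have hev : f =ᶠ[𝓝 z] Function.const E a :=
    Filter.eventually_of_mem (hU.mem_nhds hz) fun w hw ↦ ha hw
  rw [hev.fderiv_eq]; exact fderiv_const_apply _

/-- `HasFDerivAt` spelling: under the hypotheses of `exists_eqOn_const_of_re_fibre_constant`,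
`f` has derivative `0` at every point of `U`. [cite: Kodaira2005, §2.2 Thm. 2.1] -/
theorem hasFDerivAt_zero_of_re_fibre_constant {U : Set E} (hU : IsOpen U) (hUc : IsPreconnected U)
    {ψ : E → β} (hopen : IsOpenMap (U.restrict ψ)) (hsurj : SurjOn ψ U univ) {f : E → ℂ}
    (hd : DifferentiableOn ℂ f U)
    (hfib : ∀ z ∈ U, ∀ w ∈ U, ψ z = ψ w → (f z).re = (f w).re)
    {z : E} (hz : z ∈ U) : HasFDerivAt f (0 : E →L[ℂ] ℂ) z := by
  have h := (hd.differentiableAt (hU.mem_nhds hz)).hasFDerivAt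
  rwa [fderiv_eq_zero_of_re_fibre_constant hU hUc hopen hsurj hd hfib hz] at h

/-- Imaginary-part version of the cocompact form: a holomorphic function on an open preconnected
`U` whose IMAGINARY part is constant on the fibres of an open surjection `ψ|U` onto a compact
space is constant. [cite: Kodaira2005, §2.2 Thm. 2.1] -/
theorem exists_eqOn_const_of_im_fibre_constant {U : Set E} (hU : IsOpen U) (hUc : IsPreconnected U)
    {ψ : E → β} (hopen : IsOpenMap (U.restrict ψ)) (hsurj : SurjOn ψ U univ) {f : E → ℂ}
    (hd : DifferentiableOn ℂ f U)
    (hfib : ∀ z ∈ U, ∀ w ∈ U, ψ z = ψ w → (f z).im = (f w).im) :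
    ∃ a : ℂ, EqOn f (Function.const E a) U := by
  have hd' : DifferentiableOn ℂ (fun z ↦ -I * f z) U := hd.const_mul _
  have hfib' : ∀ z ∈ U, ∀ w ∈ U, ψ z = ψ w → (-I * f z).re = (-I * f w).re :=
    fun z hz w hw h ↦ by simpa using hfib z hz w hw h
  obtain ⟨a, ha⟩ := exists_eqOn_const_of_re_fibre_constant hU hUc hopen hsurj hd' hfib'
  refine ⟨I * a, fun z hz ↦ ?_⟩
  have h := ha hz
  simp only [Function.const_apply] at h ⊢
  rw [← h, ← mul_assoc, mul_neg, I_mul_I, neg_neg, one_mul]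

end Holomorphic

end Literature.Analysis.Complex
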